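import Literature.NumberTheory.Transcendental.RoyRankGenericCategory
import Literature.Barriers.Schanuel.AlgebraicIndependenceOfLogarithmsRoyKernels
import HarnessLib

/-!
# Roy 1992 over a general field: the `F`-structure of `K^{d₀} × K^{d₁}` and morphisms

Theorem-only support file (no definitions, no facts) for the field-generic deduction
`RoyRank.Thm1 F L ω → RoyRank.Thm2 F L ω` ([Roy1992] §§2–3) over the data of
`Literature.NumberTheory.Transcendental.RoyRankGenericDefs`; field-generic form of the first part of
the tree's `K = ℂ` companion `Literature.Barriers.Schanuel.AlgebraicIndependenceOfLogarithmsRoyKernels`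
(whose field-generic lemmas `Roy1992.exists_leftInverse_map`, `linearIndependent_incl_comp`,
`eq_span_range_basis` are reused by import):

* the `F`-structure `F^{d₀} × F^{d₁}` (`qPts F d₀ d₁` of `…Apparatus`): the base change
  `dim_K(K·S) = dim_F S` for `F`-subspaces of `F`-points (`finrank_span_eq_of_le_qPts`, by flattening
  `K^{d₀} × K^{d₁} ≃ K^{d₀+d₁}`), the rationality criterion `dim_K T ≤ dim_F (T ∩ F-points)`
  (`isFRational_iff_finrank_le`), and its consequences: intersections of rational subspaces are
  rational (`isFRational_inf`), ranges of morphisms are rational, injective morphisms reflect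
  `F`-points, preimages of rational subspaces under injective morphisms are rational
  (`IsBiRational.isFRational_comap`), preimages of `ℚ`-subspaces of `F^{d₀} × L^{d₁}` under
  injective morphisms lie in `F^{a₀} × L^{a₁}` (`IsBiRational.isFLogSubspace_comap`);
* `Ω = 0 × ωℚ^{d₁}` under morphisms (`mem_omega_iff`, `IsBiRational.map_omega_le`,
  `IsBiRational.comap_omega_le`: "`i⁻¹(Y ∩ Ω) = Y* ∩ Ω*` and `s(Y ∩ Ω) ⊂ Y' ∩ Ω'`", p. 28).

## References

* [Roy1992] D. Roy, *Matrices whose coefficients are linear forms in logarithms*, J. Number Theory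
  41 (1992) 22–47: Notations (p. 24); §2 Propositions 1–2 and their proofs (pp. 27–28).
-/

noncomputable section

open Module Submodule
open Literature.Barriers.Schanuel.Roy1992 (incl incl_apply incl_injective map_mulVec_incl
  linearIndependent_incl_comp eq_span_range_basis exists_leftInverse_map)

namespace Literature.NumberTheory.Transcendental.RoyRank

variable {K : Type*} [Field K] [CharZero K]
variable {F : IntermediateField ℚ K} {L : Submodule ℚ K}
variable {d₀ d₁ a₀ a₁ d₀' d₁' : ℕ}

/-! ### Flat coordinates -/

omit [CharZero K] in
/-- Coordinates of `flat v`. [folklore] -/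
theorem forall_flat_mem_iff (S : Set K) (v : LinTangent K d₀ d₁) :
    (∀ k, flat K d₀ d₁ v k ∈ S) ↔ (∀ i, v.1 i ∈ S) ∧ ∀ j, v.2 j ∈ S := by
  constructor
  · intro h
    refine ⟨fun i => ?_, fun j => ?_⟩
    · simpa [flat] using h (Fin.castAdd d₁ i)
    · simpa [flat] using h (Fin.natAdd d₀ j)
  · rintro ⟨h1, h2⟩ k
    refine Fin.addCases (fun i => ?_) (fun j => ?_) k
    · simpa [flat] using h1 i
    · simpa [flat] using h2 j

/-- `F`-points are the vectors with flat coordinates in `F`. [folklore] -/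
theorem isFPoint_iff_flat (v : LinTangent K d₀ d₁) :
    IsFPoint F v ↔ ∀ k, flat K d₀ d₁ v k ∈ F :=
  (forall_flat_mem_iff _ v).symm

/-! ### The `F`-structure `F^{d₀} × F^{d₁}` and base change -/

/-- `F^{d₀} × F^{d₁}` is the image of the coordinatewise inclusion. [folklore] -/
theorem qPts_eq_range (F : IntermediateField ℚ K) (d₀ d₁ : ℕ) :
    qPts F d₀ d₁ = LinearMap.range ((incl F K d₀).prodMap (incl F K d₁)) := by
  ext v
  rw [mem_qPts, LinearMap.mem_range]
  constructor
  · rintro ⟨h1, h2⟩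
    exact ⟨(fun i => ⟨v.1 i, h1 i⟩, fun j => ⟨v.2 j, h2 j⟩), rfl⟩
  · rintro ⟨w, rfl⟩
    exact ⟨fun i => SetLike.coe_mem _, fun j => SetLike.coe_mem _⟩

/-- `F^{d₀} × F^{d₁}` is finite dimensional over `F`. [folklore] -/
theorem finite_qPts (F : IntermediateField ℚ K) (d₀ d₁ : ℕ) : Module.Finite F (qPts F d₀ d₁ :
    Submodule F (LinTangent K d₀ d₁)) := by
  rw [qPts_eq_range]
  infer_instance

/-- The standard basis vectors are `F`-points, so `K · (F^{d₀} × F^{d₁}) = K^{d₀} × K^{d₁}`. [folklore] -/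
theorem span_qPts_eq_top (F : IntermediateField ℚ K) (d₀ d₁ : ℕ) :
    span K (qPts F d₀ d₁ : Set (LinTangent K d₀ d₁)) = ⊤ := by
  rw [eq_top_iff, ← ((Pi.basisFun K (Fin d₀)).prod (Pi.basisFun K (Fin d₁))).span_eq]
  refine span_mono ?_
  rintro _ ⟨k, rfl⟩
  rcases k with i | j
  · refine ⟨fun i' => ?_, fun j' => ?_⟩
    · rw [Basis.prod_apply_inl_fst, Pi.basisFun_apply]
      by_cases h : i' = i
      · subst h; simp
      · simp [h]
    · rw [Basis.prod_apply_inl_snd]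
      exact zero_mem _
  · refine ⟨fun i' => ?_, fun j' => ?_⟩
    · rw [Basis.prod_apply_inr_fst]
      exact zero_mem _
    · rw [Basis.prod_apply_inr_snd, Pi.basisFun_apply]
      by_cases h : j' = j
      · subst h; simp
      · simp [h]

/-- **Base change `F → K` on `K^{d₀} × K^{d₁}`**: an `F`-subspace `S` of `F`-points spans over `K` a
subspace of the same dimension, `dim_K (K·S) = dim_F S` (an `F`-basis of `S` stays `K`-independent
after flattening). [folklore] -/
theorem finrank_span_eq_of_le_qPts (S : Submodule F (LinTangent K d₀ d₁)) (hS : S ≤ qPts F d₀ d₁) :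
    finrank K (span K (S : Set (LinTangent K d₀ d₁))) = finrank F S := by
  haveI := finite_qPts F d₀ d₁
  haveI : Module.Finite F S :=
    Module.Finite.of_injective (Submodule.inclusion hS) (Submodule.inclusion_injective hS)
  set n := finrank F S
  let b : Basis (Fin n) F S := finBasis F S
  have hb : LinearIndependent F (fun i => (b i : LinTangent K d₀ d₁)) :=
    b.linearIndependent.map' S.subtype S.ker_subtype
  -- the flattened vectors have coordinates in `F`
  let w : Fin n → Fin (d₀ + d₁) → F := fun i k =>
    ⟨flat K d₀ d₁ (b i : LinTangent K d₀ d₁) k, (isFPoint_iff_flat _).1 (hS (b i).2) k⟩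
  have hw : incl F K (d₀ + d₁) ∘ w = flat K d₀ d₁ ∘ fun i => (b i : LinTangent K d₀ d₁) := by
    funext i k
    rfl
  have hwli : LinearIndependent F w := by
    apply LinearIndependent.of_comp (incl F K (d₀ + d₁))
    rw [hw]
    exact hb.map' ((flat K d₀ d₁).toLinearMap.restrictScalars F)
      (LinearMap.ker_eq_bot.2 (flat K d₀ d₁).injective)
  have hK : LinearIndependent K (incl F K (d₀ + d₁) ∘ w) := linearIndependent_incl_comp hwli
  rw [hw] at hK
  have hbK : LinearIndependent K (fun i => (b i : LinTangent K d₀ d₁)) :=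
    LinearIndependent.of_comp (flat K d₀ d₁).toLinearMap hK
  have hspan : span K (S : Set (LinTangent K d₀ d₁)) =
      span K (Set.range fun i => (b i : LinTangent K d₀ d₁)) := by
    refine le_antisymm ?_ (span_mono ?_)
    · rw [span_le]
      intro v hv
      have hT := eq_span_range_basis S b
      have hv' : v ∈ span F (Set.range fun i => (b i : LinTangent K d₀ d₁)) := by
        rw [← hT]; exact hv
      exact span_le_restrictScalars F K _ hv'
    · rintro _ ⟨i, rfl⟩
      exact (b i).2
  rw [hspan, finrank_span_eq_card hbK, Fintype.card_fin]

/-- `dim_F (F^{d₀} × F^{d₁}) = d₀ + d₁`. [folklore] -/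
theorem finrank_qPts (F : IntermediateField ℚ K) (d₀ d₁ : ℕ) :
    finrank F (qPts F d₀ d₁ : Submodule F (LinTangent K d₀ d₁)) = d₀ + d₁ := by
  rw [← finrank_span_eq_of_le_qPts (qPts F d₀ d₁) le_rfl, span_qPts_eq_top, finrank_top,
    finrank_linTangent]

/-- `qOf T ⊆ F^{d₀} × F^{d₁}`. [folklore] -/
theorem qOf_le_qPts (T : Submodule K (LinTangent K d₀ d₁)) : qOf F T ≤ qPts F d₀ d₁ := inf_le_right

/-- `qOf T` is finite dimensional over `F`. [folklore] -/
theorem finite_qOf (T : Submodule K (LinTangent K d₀ d₁)) : Module.Finite F (qOf F T) := by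
  haveI := finite_qPts F d₀ d₁
  exact Module.Finite.of_injective (Submodule.inclusion (qOf_le_qPts T))
    (Submodule.inclusion_injective _)

/-- The set of `F`-points of `T` used in `IsFRational`. [folklore] -/
theorem coe_qOf (T : Submodule K (LinTangent K d₀ d₁)) :
    (qOf F T : Set (LinTangent K d₀ d₁)) = {v | v ∈ T ∧ IsFPoint F v} := rfl

/-- `T` is rational over `F` iff `T = K · qOf T`. [cite: Roy1992, Notations (p. 24)] -/
theorem isFRational_iff_eq_span (T : Submodule K (LinTangent K d₀ d₁)) :
    IsFRational F T ↔ T = span K (qOf F T : Set (LinTangent K d₀ d₁)) := Iff.rfl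

/-- `K · qOf T ⊆ T`. [folklore] -/
theorem span_qOf_le (T : Submodule K (LinTangent K d₀ d₁)) :
    span K (qOf F T : Set (LinTangent K d₀ d₁)) ≤ T :=
  span_le.2 fun _ hv => hv.1

/-- `dim_F qOf T ≤ dim_K T`. [folklore] -/
theorem finrank_qOf_le (T : Submodule K (LinTangent K d₀ d₁)) :
    finrank F (qOf F T) ≤ finrank K T := by
  rw [← finrank_span_eq_of_le_qPts (qOf F T) (qOf_le_qPts T)]
  exact Submodule.finrank_mono (span_qOf_le T)

/-- **Rationality by dimension**: `T` is rational over `F` iff `dim_K T ≤ dim_F (qOf T)`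
(iff equality). [folklore] -/
theorem isFRational_iff_finrank_le (T : Submodule K (LinTangent K d₀ d₁)) :
    IsFRational F T ↔ finrank K T ≤ finrank F (qOf F T) := by
  rw [← finrank_span_eq_of_le_qPts (qOf F T) (qOf_le_qPts T), isFRational_iff_eq_span]
  constructor
  · intro h
    rw [← h]
  · intro h
    exact (Submodule.eq_of_le_of_finrank_le (span_qOf_le T) h).symm

/-- **The intersection of two subspaces rational over `F` is rational over `F`**
(`qOf (T₁ ∩ T₂) = qOf T₁ ∩ qOf T₂` and a dimension count with `K · (qOf T₁ + qOf T₂) ⊆ T₁ + T₂`).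
[folklore] -/
theorem isFRational_inf {T₁ T₂ : Submodule K (LinTangent K d₀ d₁)} (h₁ : IsFRational F T₁)
    (h₂ : IsFRational F T₂) : IsFRational F (T₁ ⊓ T₂) := by
  haveI := finite_qOf (F := F) T₁
  haveI := finite_qOf (F := F) T₂
  rw [isFRational_iff_finrank_le] at h₁ h₂ ⊢
  have hq : qOf F (T₁ ⊓ T₂) = qOf F T₁ ⊓ qOf F T₂ := by
    ext v
    simp only [mem_qOf, mem_inf]
    tauto
  have hsup : finrank F ↥(qOf F T₁ ⊔ qOf F T₂) ≤ finrank K ↥(T₁ ⊔ T₂) := by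
    rw [← finrank_span_eq_of_le_qPts _ (sup_le (qOf_le_qPts T₁) (qOf_le_qPts T₂))]
    apply Submodule.finrank_mono
    rw [span_le]
    intro v hv
    obtain ⟨x, hx, y, hy, rfl⟩ := Submodule.mem_sup.1 hv
    exact Submodule.mem_sup.2 ⟨x, hx.1, y, hy.1, rfl⟩
  have e1 := Submodule.finrank_sup_add_finrank_inf_eq (qOf F T₁) (qOf F T₂)
  have e2 := Submodule.finrank_sup_add_finrank_inf_eq T₁ T₂
  rw [hq]
  omega

/-! ### Morphisms and `F`-points: images, ranges, reflection, preimages -/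

variable {f : LinTangent K a₀ a₁ →ₗ[K] LinTangent K d₀ d₁}

/-- The range of a morphism is rational over `F` (it is spanned by the images of the standard
basis vectors, which are `F`-points). [folklore] -/
theorem IsBiRational.isFRational_range (hf : IsBiRational F f) :
    IsFRational F (LinearMap.range f) := by
  rw [isFRational_iff_eq_span]
  have h : LinearMap.range f = span K (f '' (qPts F a₀ a₁ : Set (LinTangent K a₀ a₁))) := by
    rw [← map_span, span_qPts_eq_top, ← LinearMap.range_eq_map]
  refine le_antisymm ?_ (span_qOf_le _)
  nth_rewrite 1 [h]
  refine span_mono ?_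
  rintro _ ⟨v, hv, rfl⟩
  exact ⟨LinearMap.mem_range_self f v, hf.isFPoint hv⟩

/-- **An injective morphism reflects `F`-points**: if `f x ∈ F^{d₀} × F^{d₁}` then
`x ∈ F^{a₀} × F^{a₁}` (the `F`-points of `range f` are the images of the `F`-points, by counting
dimensions). [folklore] -/
theorem IsBiRational.isFPoint_of_apply (hf : IsBiRational F f) (hinj : Function.Injective f)
    {x : LinTangent K a₀ a₁} (hx : IsFPoint F (f x)) : IsFPoint F x := by
  haveI := finite_qPts F a₀ a₁
  haveI := finite_qOf (F := F) (LinearMap.range f)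
  set M : Submodule F (LinTangent K d₀ d₁) := (qPts F a₀ a₁).map (f.restrictScalars F) with hM
  have hMle : M ≤ qOf F (LinearMap.range f) := by
    rintro _ ⟨v, hv, rfl⟩
    exact ⟨LinearMap.mem_range_self f v, hf.isFPoint hv⟩
  have hfinM : finrank F M = a₀ + a₁ := by
    rw [hM, ← finrank_qPts F a₀ a₁]
    exact (LinearEquiv.finrank_eq (Submodule.equivMapOfInjective _
      (show Function.Injective (f.restrictScalars F) from hinj) (qPts F a₀ a₁))).symm
  have hfinR : finrank F (qOf F (LinearMap.range f)) ≤ a₀ + a₁ := by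
    refine (finrank_qOf_le _).trans ?_
    rw [LinearMap.finrank_range_of_inj hinj, finrank_linTangent]
  have hMeq : M = qOf F (LinearMap.range f) :=
    Submodule.eq_of_le_of_finrank_le hMle (by rw [hfinM]; exact hfinR)
  have hx' : f x ∈ qOf F (LinearMap.range f) := ⟨LinearMap.mem_range_self f x, hx⟩
  rw [← hMeq, hM] at hx'
  obtain ⟨y, hy, hyx⟩ := hx'
  rw [← hinj hyx]
  exact hy

/-- **Preimages of rational subspaces under injective morphisms are rational over `F`**
(`i⁻¹(W) = i⁻¹(W ∩ range i)`, `W ∩ range i` is rational, and its `F`-points pull back to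
`F`-points). [cite: Roy1992, §2 Proposition 1 (p. 27)] -/
theorem IsBiRational.isFRational_comap (hf : IsBiRational F f) (hinj : Function.Injective f)
    {W : Submodule K (LinTangent K d₀ d₁)} (hW : IsFRational F W) : IsFRational F (W.comap f) := by
  have hR := isFRational_inf hW hf.isFRational_range
  rw [isFRational_iff_eq_span] at hR ⊢
  refine le_antisymm (fun x hx => ?_) (span_qOf_le _)
  have hfx : f x ∈ W ⊓ LinearMap.range f := ⟨hx, LinearMap.mem_range_self f x⟩
  rw [hR] at hfx
  have hle : span K (qOf F (W ⊓ LinearMap.range f) : Set (LinTangent K d₀ d₁)) ≤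
      (span K (qOf F (W.comap f) : Set (LinTangent K a₀ a₁))).map f := by
    rw [span_le]
    rintro v ⟨⟨hvW, ⟨y, rfl⟩⟩, hvq⟩
    exact ⟨y, subset_span ⟨hvW, hf.isFPoint_of_apply hinj hvq⟩, rfl⟩
  exact (Submodule.comap_map_eq_of_injective hinj _).le (hle hfx)

/-- Preimages of `ℚ`-subspaces of `F^{d₀} × L^{d₁}` under injective morphisms are contained in
`F^{a₀} × L^{a₁}` (first block: reflection of `F`-points; second block: a rational left inverse,
`L` being a `ℚ`-subspace). [cite: Roy1992, §2 Proposition 1 (p. 27)] -/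
theorem IsBiRational.isFLogSubspace_comap (hf : IsBiRational F f) (hinj : Function.Injective f)
    {Y : Submodule ℚ (LinTangent K d₀ d₁)} (hY : IsFLogSubspace F L Y) :
    IsFLogSubspace F L (Y.comap (f.restrictScalars ℚ)) := by
  obtain ⟨B₀, B₁, hdec⟩ := exists_eq_prodMap_of_isBiRational hf
  intro y hy
  obtain ⟨h1, h2⟩ := hY _ hy
  refine ⟨fun i => ?_, fun j => ?_⟩
  · -- `f (y.1, 0) = (B₀ y.1, 0)` is an `F`-point, hence so is `(y.1, 0)`
    have hpt : IsFPoint F (f (y.1, 0)) := by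
      have hf1 : (f (y.1, 0)).1 = (f y).1 := by
        rw [hdec, LinearMap.prodMap_apply, LinearMap.prodMap_apply]
      refine ⟨fun k => ?_, fun k => ?_⟩
      · rw [hf1]; exact h1 k
      · rw [hdec, LinearMap.prodMap_apply, map_zero]
        exact zero_mem _
    exact (hf.isFPoint_of_apply hinj hpt).1 i
  · -- `y.2 = C₁ (B₁ y.2)` with `C₁` rational and `B₁ y.2 ∈ L^{d₁}`
    have hinj₁ : Function.Injective (B₁.map (algebraMap ℚ K)).mulVecLin := by
      intro z z' hzz'
      have : f (0, z) = f (0, z') := by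
        rw [hdec, LinearMap.prodMap_apply, LinearMap.prodMap_apply, hzz']
      exact congrArg Prod.snd (hinj this)
    obtain ⟨C₁, hC₁⟩ := exists_leftInverse_map B₁ hinj₁
    have hy2 : y.2 = (C₁.map (algebraMap ℚ K)).mulVec ((f y).2) := by
      rw [hdec]
      simp only [LinearMap.prodMap_apply, Matrix.mulVecLin_apply, Matrix.mulVec_mulVec, hC₁,
        Matrix.one_mulVec]
    rw [hy2]
    simp only [Matrix.mulVec, dotProduct, Matrix.map_apply]
    refine sum_mem fun k _ => ?_
    rw [← Algebra.smul_def]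
    exact L.smul_mem _ (h2 k)

/-! ### `Ω` under morphisms -/

/-- Membership in `Ω = 0 × ωℚ^{d₁}`: `v.1 = 0` and every `v.2 j ∈ ℚ ω`.
[cite: Roy1992, §1 Theorem 1 (p. 25)] -/
theorem mem_omega_iff {ω : K} {v : LinTangent K d₀ d₁} :
    v ∈ Omega ω d₀ d₁ ↔ v.1 = 0 ∧ ∀ j, v.2 j ∈ (ℚ ∙ ω : Submodule ℚ K) := by
  constructor
  · intro hv
    induction hv using Submodule.span_induction with
    | mem x hx =>
      obtain ⟨j, rfl⟩ := hx
      refine ⟨rfl, fun j' => ?_⟩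
      show (Pi.single j ω : Fin d₁ → K) j' ∈ _
      by_cases h : j' = j
      · subst h
        rw [Pi.single_eq_same]
        exact Submodule.mem_span_singleton_self _
      · rw [Pi.single_eq_of_ne h]
        exact zero_mem _
    | zero => exact ⟨rfl, fun _ => zero_mem _⟩
    | add x y _ _ hx hy =>
      exact ⟨by rw [Prod.fst_add, hx.1, hy.1, add_zero], fun j => add_mem (hx.2 j) (hy.2 j)⟩
    | smul c x _ hx =>
      refine ⟨by rw [Prod.smul_fst, hx.1, smul_zero], fun j => ?_⟩
      rw [Prod.smul_snd, Pi.smul_apply]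
      exact Submodule.smul_mem _ _ (hx.2 j)
  · rintro ⟨h1, h2⟩
    have hv : v = ∑ j, ((0 : Fin d₀ → K), Pi.single j (v.2 j)) := by
      ext k
      · rw [h1, Prod.fst_sum]
        simp
      · rw [Prod.snd_sum]
        simp
    rw [hv]
    refine Submodule.sum_mem _ fun j _ => ?_
    obtain ⟨a, ha⟩ := Submodule.mem_span_singleton.1 (h2 j)
    have : ((0 : Fin d₀ → K), (Pi.single j (v.2 j) : Fin d₁ → K)) =
        a • ((0 : Fin d₀ → K), (Pi.single j ω : Fin d₁ → K)) := by
      ext k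
      · simp
      · by_cases hk : k = j
        · subst hk
          simp [ha]
        · simp [hk]
    rw [this]
    exact Submodule.smul_mem _ _ (Submodule.subset_span ⟨j, rfl⟩)

omit [CharZero K] in
/-- A matrix with rational entries preserves "all coordinates in the `ℚ`-subspace `S`" (`K` any
field of characteristic zero). [folklore] -/
theorem mulVec_map_mem_of_forall_mem [Algebra ℚ K] {m n : ℕ} (S : Submodule ℚ K)
    (C : Matrix (Fin m) (Fin n) ℚ) {z : Fin n → K} (hz : ∀ k, z k ∈ S) (j : Fin m) :
    (C.map (algebraMap ℚ K)).mulVec z j ∈ S := by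
  simp only [Matrix.mulVec, dotProduct, Matrix.map_apply]
  refine sum_mem fun k _ => ?_
  rw [← Algebra.smul_def]
  exact S.smul_mem _ (hz k)

/-- Morphisms map `Ω` into `Ω'` ("`s(Y ∩ Ω) ⊂ Y' ∩ Ω'`"). [cite: Roy1992, §2 proof of Proposition 2 (p. 28)] -/
theorem IsBiRational.map_omega_le {ω : K} {s : LinTangent K d₀ d₁ →ₗ[K] LinTangent K d₀' d₁'}
    (hs : IsBiRational F s) : (Omega ω d₀ d₁).map (s.restrictScalars ℚ) ≤ Omega ω d₀' d₁' := by
  obtain ⟨A₀, A₁, hdec⟩ := exists_eq_prodMap_of_isBiRational hs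
  rintro _ ⟨v, hv, rfl⟩
  obtain ⟨h1, h2⟩ := mem_omega_iff.1 hv
  rw [mem_omega_iff, LinearMap.restrictScalars_apply, hdec, LinearMap.prodMap_apply, h1, map_zero]
  exact ⟨rfl, fun j => mulVec_map_mem_of_forall_mem _ A₁ h2 j⟩

/-- Injective morphisms pull `Ω` back into `Ω*` ("`i⁻¹(Y ∩ Ω) = Y* ∩ Ω*`").
[cite: Roy1992, §2 proof of Proposition 2 (p. 28)] -/
theorem IsBiRational.comap_omega_le {ω : K} {i : LinTangent K a₀ a₁ →ₗ[K] LinTangent K d₀ d₁}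
    (hi : IsBiRational F i) (hinj : Function.Injective i) :
    (Omega ω d₀ d₁).comap (i.restrictScalars ℚ) ≤ Omega ω a₀ a₁ := by
  obtain ⟨B₀, B₁, hdec⟩ := exists_eq_prodMap_of_isBiRational hi
  intro x hx
  rw [Submodule.mem_comap, LinearMap.restrictScalars_apply] at hx
  obtain ⟨h1, h2⟩ := mem_omega_iff.1 hx
  have hinj₀ : Function.Injective (B₀.map (algebraMap F K)).mulVecLin := by
    intro z z' hzz'
    have : i (z, 0) = i (z', 0) := by
      rw [hdec, LinearMap.prodMap_apply, LinearMap.prodMap_apply, hzz']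
    exact congrArg Prod.fst (hinj this)
  have hinj₁ : Function.Injective (B₁.map (algebraMap ℚ K)).mulVecLin := by
    intro z z' hzz'
    have : i (0, z) = i (0, z') := by
      rw [hdec, LinearMap.prodMap_apply, LinearMap.prodMap_apply, hzz']
    exact congrArg Prod.snd (hinj this)
  obtain ⟨C₁, hC₁⟩ := exists_leftInverse_map B₁ hinj₁
  rw [mem_omega_iff]
  refine ⟨?_, fun j => ?_⟩
  · apply hinj₀
    rw [map_zero]
    have : (i x).1 = (B₀.map (algebraMap F K)).mulVecLin x.1 := by
      rw [hdec, LinearMap.prodMap_apply]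
    rw [← this, h1]
  · have hx2 : x.2 = (C₁.map (algebraMap ℚ K)).mulVec ((i x).2) := by
      rw [hdec]
      simp only [LinearMap.prodMap_apply, Matrix.mulVecLin_apply, Matrix.mulVec_mulVec, hC₁,
        Matrix.one_mulVec]
    rw [hx2]
    exact mulVec_map_mem_of_forall_mem _ C₁ h2 j

end Literature.NumberTheory.Transcendental.RoyRank
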